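import Literature.AlgebraicGeometry.AbelianSchemes.PoincareGrothendieckComplexResidueFieldRepr
import Literature.AlgebraicGeometry.AbelianSchemes.AbelianSchemeSmallExtensionPicardTorsor
import Literature.AlgebraicGeometry.Modules.CechComplexTorsionOffBasicOpen
import Literature.AlgebraicGeometry.Modules.CechProductCoverColumnCollapse
import Literature.AlgebraicGeometry.AbelianVarieties.PicZeroCohomologyVanishing
import Literature.Algebra.Homology.TorsionCocyclesOfQuasiIso
import Literature.Algebra.Homology.LocallyNilpotentCocyclesSpan
import HarnessLib

/-!
# The Grothendieck complex of the Poincaré bundle, base-changed to the local ring at `0̂`, has `𝔪`-power-torsion cohomology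
# ([MumfordAV1970] §13, proof of the Theorem, pp. 127–128: «the support of `Rⁱp_{2,*}(P)` is `{0̂}`»)

Layer `Literature/AlgebraicGeometry/AbelianSchemes`, namespace `Literature.AlgebraicGeometry.AbelianSchemes.AbelianSchemeOver`.  THEOREMS ONLY (no
definition, no named fact, no instance, no notation, no `sorry`).  Cell `hodgecm-mathlib` (D-0151), P6 «MOD programme», junction **(NIL)** of the
«H1-DIM-ANY-CHAR cut» (B-p04 (g42), memo `MEMO-H1DIM-cut.v4`), FILE 4a: the input `hnil` («every `r ∈ 𝔪_R` acts locally nilpotently on every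
cohomology module of `K•_R = R ⊗ K•`») of ★ (h₂-WIRING) `finrank_HOne_baseChangeComplex_residueField_eq_of_torsion` for the Grothendieck complex of the
Poincaré family over an affine test base through the unit point (the standing data of ★ `PoincareGrothendieckComplexResidueFieldRepr`).

THE MATHEMATICS.  Standing Poincaré data over an algebraically closed field `K` (`A hat π L hε hker P hsock hP1`, with `hpic`: every slice
`𝒫|_{A × {b}}` lies in `Pic⁰`), an affine test base `gT : T → Â` (injective on schemes, locally of finite type) with its `K`-point `t₀` over the
unit section, a cover `𝓥` of `A × T` with affine finite intersections, `K• ⥲ Č•(𝓥, 𝒫_T)` the Grothendieck complex, and a local `Γ(T)`-algebra `R`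
with `𝔪_R = (ker t₀♯) R`.
* §1 **`exists_isPullback_slice_cechComplex_exactAt`** — at a `K`-point `b ≠ t₀` of `T` the slice `A × {b} → A × T` (★ `isPullback_whiskerLeft_left_snd`)
  carries `𝒫_T` to `𝒫|_{A × {gT b}}`, a rank-one HOMOGENEOUS line bundle which is NOT trivial (else `b = t₀` by points-injectivity ★
  `eq_of_nonempty_pullback_poincare_iso_unitModule` and `Mono gT`), so its ordered Čech complex is exact in every degree (★ D1
  `subsingleton_cechComplex_homology_of_isHomogeneous'`, [MumfordAV1970] §8 (vii)) — the hypothesis `hfib` of ★ B4 off `V(f)` for `f ∈ ker t₀♯`;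
* §2 **`locallyNilpotent_cocycles_baseChangeComplex_grothendieckComplex`** — for every `r ∈ 𝔪_R`, every degree and every cocycle `z` of
  `baseChangeComplex R K•`, some `rᵏ • z` is a coboundary: ★ B4 §3 `exists_pow_smul_eq_baseChange_d_of_forall_kPoint_basicOpen` on `Č•`, moved to
  `K•` by ★ J4 `exists_pow_algebraMap_smul_eq_baseChange_d_of_quasiIso`, extended from the generators `algebraMap (ker t₀♯)` of `𝔪_R` by ★
  `locallyNilpotent_cocycles_of_maximalIdeal`; and the list form `…_of_subset_maximalIdeal` eaten by ★ (h₂-WIRING).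

HC_CM is proved only modulo the printed citations until rung 0 closes; nothing here is about HC (count-neutral ★ capital).

## References
* [MumfordAV1970] D. Mumford, *Abelian Varieties* (1970), §13, proof of the Theorem (pp. 127–128); §8 (vii) (p. 76).
* [Hartshorne1977] R. Hartshorne, *Algebraic Geometry* (1977), III Thm. 12.11 (p. 290), III Prop. 9.3 (p. 255).
* [GortzWedhorn2023] U. Görtz, T. Wedhorn, *Algebraic Geometry II* (2023), Prop. 22.90 (p. 277), Cor. 23.135 (p. 355).
-/

set_option autoImplicit false

noncomputable section

-- `Scheme.Modules` / cartesian-monoidal `Over` products are not reducible (as in ★ `PoincareGrothendieckComplexResidueFieldRepr`).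
set_option backward.isDefEq.respectTransparency false

open CategoryTheory CategoryTheory.Limits AlgebraicGeometry MonoidalCategory CartesianMonoidalCategory TensorProduct IsLocalRing
open scoped MonObj

namespace Literature.AlgebraicGeometry.AbelianSchemes

namespace AbelianSchemeOver

open Literature.AlgebraicGeometry.Motives Literature.AlgebraicGeometry.Modules Literature.Algebra.Homology
  Literature.AlgebraicGeometry.AbelianVarieties

variable {K : Type} [Field K] [IsAlgClosed K] (A hat : AbelianSchemeOver (Spec (CommRingCat.of K))) (π : A.X ⟶ hat.X) [IsMonHom π]
  [Flat π.left] [Surjective π.left]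
  {L : A.left.Modules} (hL : HasRank L 1)
  (hε : CechPic.pullback A.unitSection (detClass (HasRank.isFiniteLocallyFree' hL)) = 1)
  (hker : ∀ (T : Over (Spec (CommRingCat.of K))) (u : T ⟶ A.X), u ≫ π = 1 ↔ A.MemKOfL L u)
  (P : (A.prodLeft hat).Modules)
  (hsock : Nonempty ((Scheme.Modules.pullback (A.X ◁ π).left).obj P ≅ A.mumfordBundle L)) (hP1 : HasRank P 1)
  (hpic : ∀ b : Spec (CommRingCat.of K) ⟶ hat.X.left,
    IsHomogeneous (A.fibre (b ≫ hat.X.hom)).toAbelianVariety ((Scheme.Modules.pullback (A.fibreSlice hat b)).obj P))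
  -- the affine test base `T → Â`, injective on schemes, with its `K`-point `t₀` over the unit section
  (T : SchemeOver K) [IsAffine T.left] [IsNoetherianRing Γ(T.left, ⊤)] [IsLocallyNoetherian T.left] [LocallyOfFiniteType T.hom]
  (gT : T ⟶ hat.X) [Mono gT.left]
  (t₀ : Spec (CommRingCat.of K) ⟶ T.left) (ht₀ : t₀ ≫ gT.left = hat.unitSection) (ht₀K : t₀ ≫ T.hom = 𝟙 _)
  {κ : Type} [LinearOrder κ] [Fintype κ] (𝓥 : κ → (A.X ⊗ T).left.Opens)
  (hV : ∀ s : Finset κ, s.Nonempty → IsAffineOpen (cechOpen 𝓥 s)) (hcov : ⨆ i, 𝓥 i = ⊤)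
  (hPT : HasRank ((Scheme.Modules.pullback (A.X ◁ gT).left).obj P) 1)
  [IsProper A.X.hom] [GeometricallyIntegral A.X.hom] [Flat A.X.hom] [UniversallyOpen A.X.hom]
  -- the local ring `R` under `Γ(T)` whose maximal ideal is generated by the ideal of `t₀`
  {R : Type} [CommRing R] [Algebra Γ(T.left, ⊤) R] [IsLocalRing R]
  (hmax : (RingHom.ker t₀.appTop.hom).map (algebraMap Γ(T.left, ⊤) R) = maximalIdeal R)

/-! ## §1 The slice at a `K`-point `b ≠ t₀`: exact Čech complex -/

include hL hε hker hsock hpic ht₀ hV hcov hPT in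
omit [IsNoetherianRing Γ(T.left, ⊤)] [IsLocallyNoetherian T.left] [LocallyOfFiniteType T.hom]
  [IsProper A.X.hom] [GeometricallyIntegral A.X.hom] [Flat A.X.hom] [UniversallyOpen A.X.hom] in
/-- **THE POINCARÉ SLICE AT A `K`-POINT `b ≠ t₀` OF THE TEST BASE HAS EXACT ČECH COMPLEX.**  The square `A × {b} → A × T` over `b : Spec K → T`
(★ `isPullback_whiskerLeft_left_snd`) pulls `𝒫_T` back to `𝒫|_{A × {gT b}}`: rank one, homogeneous (`hpic`), and not `≅ 𝒪` (otherwise `b ≫ gT = t₀ ≫ gT`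
by ★ points-injectivity, so `b = t₀`); hence `Ȟⁱ = 0` for all `i` (★ D1), in the scalars of the fibre's structure map.
[cite: MumfordAV1970, §8 (vii) (p. 76) and §13 (pp. 127–128)] -/
theorem exists_isPullback_slice_cechComplex_exactAt (b : Spec (CommRingCat.of K) ⟶ T.left) (hb : b ≫ T.hom = 𝟙 _) (hbt : b ≠ t₀) :
    ∃ (F : Scheme.{0}) (kX : F ⟶ (A.X ⊗ T).left) (g' : F ⟶ Spec (CommRingCat.of K)) (_ : IsPullback kX g' (snd A.X T).left b),
      ∀ i : ℤ, (cechComplex (fun j => kX ⁻¹ᵁ 𝓥 j)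
        ((Scheme.Modules.pullback kX).obj ((Scheme.Modules.pullback (A.X ◁ gT).left).obj P)) g'.appTop.hom).ExactAt i := by
  -- the `K`-point of `Â` under `b` and the test object `T' = (Spec K → Â)` it defines
  set b' : Spec (CommRingCat.of K) ⟶ hat.X.left := b ≫ gT.left with hb'
  let T' : Over (Spec (CommRingCat.of K)) := Over.mk (b' ≫ hat.X.hom)
  have hw : b ≫ T.hom = b' ≫ hat.X.hom := by rw [hb', Category.assoc, Over.w gT]
  let jb : T' ⟶ T := Over.homMk b hw
  have hjb : jb.left = b := rfl
  -- the slice square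
  have sq : IsPullback (A.X ◁ jb).left (pullback.snd A.X.hom T'.hom) (snd A.X T).left b :=
    isPullback_whiskerLeft_left_snd A.X jb
  refine ⟨(A.X ⊗ T').left, (A.X ◁ jb).left, pullback.snd A.X.hom T'.hom, sq, fun i => ?_⟩
  -- the slice module is `𝒫|_{A × {b'}}`
  have hcomp : (A.X ◁ jb).left ≫ (A.X ◁ gT).left = A.fibreSlice hat b' := by
    rw [← Over.comp_left, ← MonoidalCategory.whiskerLeft_comp]
    apply pullback.hom_ext
    · rw [Over.whiskerLeft_left_fst, fibreSlice_fst]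
      rfl
    · rw [Over.whiskerLeft_left_snd, fibreSlice_snd, Over.comp_left, hjb]
      rfl
  let M : (A.X ⊗ T').left.Modules := (Scheme.Modules.pullback (A.X ◁ jb).left).obj ((Scheme.Modules.pullback (A.X ◁ gT).left).obj P)
  have eM : M ≅ (Scheme.Modules.pullback (A.fibreSlice hat b')).obj P :=
    (Scheme.Modules.pullbackComp (A.X ◁ jb).left (A.X ◁ gT).left).app P ≪≫ (Scheme.Modules.pullbackCongr hcomp).app P
  -- rank one, homogeneous
  have hM1 : HasRank M 1 := hasRank_pullback _ hPT
  have hhom : IsHomogeneous (A.fibre (b' ≫ hat.X.hom)).toAbelianVariety M := (hpic b').of_iso eM.symm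
  -- not trivial: otherwise `jb ≫ gT` is the unit point, i.e. `b = t₀`
  have hne : IsEmpty (M ≅ unitModule (A.X ⊗ T').left) := by
    refine ⟨fun e => hbt ?_⟩
    have hg : Nonempty ((Scheme.Modules.pullback (A.X ◁ (jb ≫ gT)).left).obj P ≅ unitModule (A.X ⊗ T').left) := by
      have hc : (A.X ◁ jb).left ≫ (A.X ◁ gT).left = (A.X ◁ (jb ≫ gT)).left := by
        rw [← Over.comp_left, ← MonoidalCategory.whiskerLeft_comp]
      exact ⟨((Scheme.Modules.pullbackCongr hc).app P).symm ≪≫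
        ((Scheme.Modules.pullbackComp (A.X ◁ jb).left (A.X ◁ gT).left).app P).symm ≪≫ e⟩
    have h1 := A.eq_of_nonempty_pullback_poincare_iso_unitModule hat π hL hε hker P hsock (jb ≫ gT) 1 hg
      (A.nonempty_pullback_whiskerLeft_one_poincare_iso_unitModule hat π hL hε P hsock T')
    have h2 : b ≫ gT.left = T'.hom ≫ hat.unitSection := by
      have h1' : (jb ≫ gT).left = (1 : T' ⟶ hat.X).left := by rw [h1]
      rw [Over.comp_left, hjb, Hom.one_def, Over.comp_left, Over.toUnit_left] at h1'
      exact h1'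
    have hT' : T'.hom = 𝟙 _ := by
      change b' ≫ hat.X.hom = 𝟙 _
      rw [hb', Category.assoc, Over.w gT, hb]
    rw [hT', Category.id_comp, ← ht₀] at h2
    exact (cancel_mono gT.left).1 h2
  -- the affine cover of the slice
  haveI : IsAffineHom b := isAffineHom_of_isAffine b
  haveI : IsAffineHom (A.X ◁ jb).left := MorphismProperty.of_isPullback (P := @IsAffineHom) sq.flip inferInstance
  have hUa : ∀ j, IsAffineOpen ((A.X ◁ jb).left ⁻¹ᵁ 𝓥 j) := fun j => by
    have h := hV {j} (Finset.singleton_nonempty j)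
    rw [cechOpen_singleton] at h
    exact h.preimage _
  have hcov' : ⨆ j, (A.X ◁ jb).left ⁻¹ᵁ 𝓥 j = ⊤ := by
    rw [← Scheme.Hom.preimage_iSup, hcov, Scheme.Hom.preimage_top]
  -- D1: all Čech cohomology of a non-trivial homogeneous line bundle vanishes
  have hsub := subsingleton_cechComplex_homology_of_isHomogeneous' (A.fibre (b' ≫ hat.X.hom)).toAbelianVariety hM1 hhom hne
    (fun j => ⟨(A.X ◁ jb).left ⁻¹ᵁ 𝓥 j, hUa j⟩) hcov' i
  have hex : (cechComplex (fun j => (A.X ◁ jb).left ⁻¹ᵁ 𝓥 j) M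
      (scalarRingHomTop (A.fibre (b' ≫ hat.X.hom)).toAbelianVariety.X)).ExactAt i := by
    rw [HomologicalComplex.exactAt_iff_isZero_homology]
    exact ModuleCat.isZero_of_subsingleton _
  exact (exactAt_cechComplex_iff_of_scalars _ M _ _ i).1 hex

/-! ## §2 `𝔪_R`-power torsion of the cohomology of `R ⊗ K•` -/

omit [IsAlgClosed K] in
/-- A `K`-point at which a global function VANISHES does not lie in its basic open (`t⁻¹ D(f) = D(t♯ f) = D(0) = ∅`). [cite: StacksProject, Tag 01JO] -/
theorem not_mem_basicOpen_of_appTop_eq_zero {Y : Scheme.{0}} (t : Spec (CommRingCat.of K) ⟶ Y) (f : Γ(Y, ⊤)) (hf : t.appTop.hom f = 0)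
    (p : Spec (CommRingCat.of K)) : t.base p ∉ Y.basicOpen f := by
  intro h
  have h' : p ∈ t ⁻¹ᵁ Y.basicOpen f := h
  rw [Scheme.preimage_basicOpen_top] at h'
  have h0 : t.appTop f = 0 := hf
  rw [h0, Scheme.basicOpen_zero] at h'
  exact h'


include hL hε hker hsock hpic ht₀ ht₀K hmax in
/-- **EVERY `r ∈ 𝔪_R` ACTS LOCALLY NILPOTENTLY ON EVERY COHOMOLOGY MODULE OF `R ⊗_{Γ(T)} K•`** for the Grothendieck complex `K•` of the Poincaré
family over an affine test base through the unit point, `R` local under `Γ(T)` with `𝔪_R = (ker t₀♯) R` — the `hnil` input of ★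
`finrank_HOne_baseChangeComplex_residueField_eq_of_torsion`.  (★ B4 §3 on `Č•` with §1 as `hfib` off `V(f)`, `f ∈ ker t₀♯`; ★ J4 to `K•`; ★
`locallyNilpotent_cocycles_of_maximalIdeal` from the generators `algebraMap (ker t₀♯)` of `𝔪_R`.) [cite: MumfordAV1970, §13, proof of the Theorem (pp. 127–128)]
[cite: Hartshorne1977, III Thm. 12.11 (p. 290)] -/
theorem locallyNilpotent_cocycles_baseChangeComplex_grothendieckComplex :
    ∀ r ∈ maximalIdeal R, ∀ (i j l : ℤ), i + 1 = j → j + 1 = l →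
      ∀ z : (baseChangeComplex R (grothendieckComplex A.X T 𝓥 ((Scheme.Modules.pullback (A.X ◁ gT).left).obj P) hV hcov hPT)).X j,
        ((baseChangeComplex R (grothendieckComplex A.X T 𝓥 ((Scheme.Modules.pullback (A.X ◁ gT).left).obj P) hV hcov hPT)).d j l).hom z = 0 →
        ∃ (k : ℕ) (w : (baseChangeComplex R
            (grothendieckComplex A.X T 𝓥 ((Scheme.Modules.pullback (A.X ◁ gT).left).obj P) hV hcov hPT)).X i),
          r ^ k • z = ((baseChangeComplex R
            (grothendieckComplex A.X T 𝓥 ((Scheme.Modules.pullback (A.X ◁ gT).left).obj P) hV hcov hPT)).d i j).hom w := by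
  have hsp := grothendieckComplex_spec A.X T 𝓥 ((Scheme.Modules.pullback (A.X ◁ gT).left).obj P) hV hcov hPT
  haveI := hsp.1
  haveI := hsp.2.2.1
  have hGff : IsFiniteLocallyFree ((Scheme.Modules.pullback (A.X ◁ gT).left).obj P) := HasRank.isFiniteLocallyFree' hPT
  haveI : IsProper (snd A.X T).left := by
    change IsProper (pullback.snd A.X.hom T.hom)
    exact MorphismProperty.pullback_snd (P := @IsProper) _ _ inferInstance
  haveI : Flat (snd A.X T).left := by
    change Flat (pullback.snd A.X.hom T.hom)
    exact MorphismProperty.pullback_snd (P := @Flat) _ _ inferInstance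
  haveI : (cechComplex 𝓥 ((Scheme.Modules.pullback (A.X ◁ gT).left).obj P) (baseToTotal A.X T)).IsStrictlyLE (Fintype.card κ : ℤ) :=
    isStrictlyLE_cechComplex _ _ _ _ (by omega)
  have hKflat : ∀ n, Module.Flat Γ(T.left, ⊤)
      ((grothendieckComplex A.X T 𝓥 ((Scheme.Modules.pullback (A.X ◁ gT).left).obj P) hV hcov hPT).X n) := fun n => by
    haveI := (hsp.2.2.2 n).2
    exact Module.Flat.of_projective
  have hCflat : ∀ n, Module.Flat Γ(T.left, ⊤)
      ((cechComplex 𝓥 ((Scheme.Modules.pullback (A.X ◁ gT).left).obj P) (baseToTotal A.X T)).X n) :=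
    flat_cechComplex_X 𝓥 _ _ (flat_secMod_of_flat (snd A.X T).left 𝓥 hV _ hGff)
  -- reduce to the generators `algebraMap (ker t₀♯)` of `𝔪_R`
  refine locallyNilpotent_cocycles_of_maximalIdeal _
    (S := (algebraMap Γ(T.left, ⊤) R) '' (RingHom.ker t₀.appTop.hom : Set Γ(T.left, ⊤))) hmax ?_
  rintro _ ⟨f, hf, rfl⟩ i j l hij hjl z hz
  -- fibres over `D(f)` are slices at `K`-points `b ≠ t₀`
  have hfib : ∀ b : Spec (CommRingCat.of K) ⟶ T.left, b ≫ T.hom = 𝟙 _ → b.base (IsLocalRing.closedPoint K) ∈ T.left.basicOpen f →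
      ∃ (F : Scheme.{0}) (kX : F ⟶ (A.X ⊗ T).left) (g' : F ⟶ Spec (CommRingCat.of K)) (_ : IsPullback kX g' (snd A.X T).left b),
        ∀ i : ℤ, (cechComplex (fun j => kX ⁻¹ᵁ 𝓥 j)
          ((Scheme.Modules.pullback kX).obj ((Scheme.Modules.pullback (A.X ◁ gT).left).obj P)) g'.appTop.hom).ExactAt i := by
    intro b hb hbD
    have hbt : b ≠ t₀ := by
      rintro rfl
      exact not_mem_basicOpen_of_appTop_eq_zero b f hf _ hbD
    exact A.exists_isPullback_slice_cechComplex_exactAt hat π hL hε hker P hsock hpic T gT t₀ ht₀ 𝓥 hV hcov hPT b hb hbt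
  -- ★ B4 on the Čech complex, ★ J4 to the Grothendieck complex
  have hC := exists_pow_smul_eq_baseChange_d_of_forall_kPoint_basicOpen (snd A.X T).left T.hom 𝓥 hcov hV
    ((Scheme.Modules.pullback (A.X ◁ gT).left).obj P) hGff f hfib R i j l hij hjl
  exact exists_pow_algebraMap_smul_eq_baseChange_d_of_quasiIso
    (grothendieckMap A.X T 𝓥 ((Scheme.Modules.pullback (A.X ◁ gT).left).obj P) hV hcov hPT) R hKflat hCflat
    (Fintype.card κ : ℤ) f i j l hij hjl hC z hz

end AbelianSchemeOver

end Literature.AlgebraicGeometry.AbelianSchemes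

end
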